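import Summits.Ventures.HodgeRepro2.T5SU11LegendreLaplaceHeine
import Summits.Ventures.HodgeRepro2.T5SU11LegendreSummary

/-!
# The Laplace–Heine asymptotic in the variable `x`: `√n · P_n(x)/ρ(x)ⁿ → 1/√(π(1 − ρ(x)^{−2}))` for `x > 1`,
and on the group `√n · φ_{2n+2}(g)/(|a| + |b|)^{2n} → 1/√(π(1 − (|a| + |b|)^{−4}))` for `g ∉ K`

`T5SU11LegendreLaplaceHeine.tendsto_sqrt_mul_exp_neg_mul_legP_cosh` at `x = cosh 2t`, `t = arcosh(x)/2 > 0`, with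
`ρ(x) = e^{2t}` (`T5SU11LegendreGenerating.rho_cosh`), reads **`√n · P_n(x)/ρ(x)ⁿ → 1/√(π(1 − ρ(x)^{−2}))`**
(`tendsto_sqrt_mul_legP_div_rho_pow`); on the group, with `ρ(φ_4(g)) = (|a| + |b|)²` and `φ_4(g) > 1` exactly when
`g ∉ K` (i.e. `b(g) ≠ 0`), **`√n · φ_{2n+2}(g)/(|a| + |b|)^{2n} → 1/√(π(1 − (|a| + |b|)^{−4}))`**
(`tendsto_sqrt_mul_sph_even_div`). Nothing is claimed about (N).

Blind lane: Mathlib + the HodgeRepro2 prefix only; no sorry; axioms ⊆ {propext, Classical.choice,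
Quot.sound}.
-/

namespace Summit.Ventures.HodgeRepro2.T5SU11LegendreLaplaceHeineX

open Filter Topology
open T5SU11Unimodular T5SU11Cartan T5BergmanCoefficient T5SU11SphericalFunction T5SU11SphericalLegendre
  T5SU11SphericalLegendreAll T5SU11LegendreGenerating T5SU11LegendreSummary T5SU11LegendreLaplaceHeine

/-- Every `x > 1` is `cosh 2t` for a unique `t > 0`. -/
theorem exists_cosh_two_mul_eq_of_one_lt {x : ℝ} (hx : 1 < x) : ∃ t : ℝ, 0 < t ∧ Real.cosh (2 * t) = x := by
  obtain ⟨t, ht0, ht⟩ := exists_cosh_two_mul_eq hx.le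
  refine ⟨t, lt_of_le_of_ne ht0 fun h => ?_, ht⟩
  rw [← h, mul_zero, Real.cosh_zero] at ht
  linarith

/-- **`√n · P_n(x)/ρ(x)ⁿ → 1/√(π(1 − ρ(x)^{−2}))`** for `x > 1`. -/
theorem tendsto_sqrt_mul_legP_div_rho_pow {x : ℝ} (hx : 1 < x) :
    Tendsto (fun n : ℕ => Real.sqrt n * (legP n x / rho x ^ n)) atTop
      (𝓝 (1 / Real.sqrt (Real.pi * (1 - (rho x ^ 2)⁻¹)))) := by
  obtain ⟨t, ht, rfl⟩ := exists_cosh_two_mul_eq_of_one_lt hx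
  have h := tendsto_sqrt_mul_exp_neg_mul_legP_cosh ht
  rw [rho_cosh ht.le]
  have e1 : Real.exp (-(4 * t)) = (Real.exp (2 * t) ^ 2)⁻¹ := by
    rw [← Real.exp_nat_mul, ← Real.exp_neg]
    congr 1
    push_cast
    ring
  rw [e1] at h
  refine h.congr fun n => ?_
  rw [div_eq_mul_inv, ← Real.exp_nat_mul, ← Real.exp_neg, mul_comm (legP _ _),
    show -((n : ℝ) * (2 * t)) = -(2 * (n : ℝ)) * t by ring]

section measure

variable [MeasurableSpace Circle] [BorelSpace Circle]

/-- **On the group**: for `g ∉ K` (`b(g) ≠ 0`),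
`√n · φ_{2n+2}(g)/(|a(g)| + |b(g)|)^{2n} → 1/√(π(1 − (|a(g)| + |b(g)|)^{−4}))`. -/
theorem tendsto_sqrt_mul_sph_even_div (g : SU11) (hb : mat g 0 1 ≠ 0) :
    Tendsto (fun n : ℕ => Real.sqrt n * (sph (2 * (n : ℝ) + 2) g / ((‖mat g 0 0‖ + ‖mat g 0 1‖) ^ 2) ^ n)) atTop
      (𝓝 (1 / Real.sqrt (Real.pi * (1 - (((‖mat g 0 0‖ + ‖mat g 0 1‖) ^ 2) ^ 2)⁻¹)))) := by
  have hx : 1 < sph 4 g := by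
    rw [sph_four_eq_add]
    have h1 : 1 ≤ ‖mat g 0 0‖ ^ 2 := by
      have := one_le_sph_four g
      rw [sph_four] at this
      linarith
    have h2 : 0 < ‖mat g 0 1‖ ^ 2 := by positivity
    linarith
  have h := tendsto_sqrt_mul_legP_div_rho_pow hx
  rw [rho_sph_four] at h
  simp only [sph_even_eq_sph_four]
  exact h

end measure

end Summit.Ventures.HodgeRepro2.T5SU11LegendreLaplaceHeineX
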